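import Summits.Ventures.YMGap.Thresholds.CouplingDerivative
import Summits.Ventures.YMGap.Thresholds.CouplingDerivativeSUN
import Summits.Ventures.YMGap.RobustBall.StringTensionCentreTubeFR
import Summits.Ventures.YMGap.RobustBall.StringTensionCentreTubeW
import Summits.Ventures.YMGap.RobustBall.MassGapOnBallZdGRowsSUNStar
import Summits.Ventures.YMGap.RobustBall.OneStateStarSU3PV
import Summits.Ventures.YMGap.RobustBall.StringTensionOnBallSU3PV
import Summits.Ventures.YMGap.RobustBall.RowsSU3StarPV
import Summits.Ventures.YMGap.RobustBall.StringTensionLawAsymptotic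
import Summits.Ventures.YMGap.RobustBall.StaticPotentialEveryN
import Summits.Ventures.YMGap.RobustBall.UniformRateStrongCoupling
import HarnessLib

/-!
# Venture statement — YMGap (cell `pub-ymgap`) — CONJUNCT BODIES T42, T43, T44, T47, T48 (track Y2 / Wilson action at strong coupling) (seat p3-g6)

STATUS: BOOKED by the lead's R253 (2026-08-23T11:53Z) FOR v1.10 «IF the owner-countersigned T-text is in p3's hands by 14:30Z, else V21»; this is
the SECOND block file of v1.10 (the first, `StatementConjunctsV20.lean`, carries T40, T41; two files because of the 400-line cap). Texts: T43 = seat ds-4 g9's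
own text verbatim; T42 (i)–(iii) = seat ds-1 g8's own texts verbatim; T47 (i)(iii)(iv) = seat rb-p2 g5's own texts
verbatim; T48 (ii)–(iv) = seat rb-p1 g4's own text verbatim; T42 (iv) / T44 / T47 (ii)(v) / T48 (i) drafted by p3 from the TREE declarations named by rb-theory (2026-08-23T11:50Z, items (2)–(6)) and booked by
the lead, each countersigned by its owner seat (T42 ds-1, T44 ds-2 / engine-2, T47 rb-p2, T48 rb-p1) — a section whose countersign is missing at staging time is dropped
from this file and from the v1.10 conjunction (it goes to V21). T45 (Y4 UV-side ceilings) = NO (R253 (c)); T46 (p2's K₂B ladder) → V21. The index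
entry `YMGapStatementV1_10 := YMGapStatementV1_9 ∧ T40 ∧ T41 ∧ T42 ∧ T43 ∧ T44 ∧ T47 ∧ T48` (the countersigned subset) is appended to
`StatementIndex.lean` (PLAN R215) after both block files land. Next free number: T49.

HONEST FRAMING. WHAT THIS IS: bodies `Tk_… : Prop` + witnesses `Tk_…_holds` of conjuncts of the venture statement (index of record:
`Summits/Ventures/YMGap/Statement.lean` frozen at v1.6, continued in `StatementIndex.lean`), kernel-checked with NO hypothesis, closing by TREE
constants only — every body below is the TYPE of the named tree theorem(s) with its hypotheses turned into binders, nothing weakened or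
strengthened. STRONG-COUPLING LATTICE STATEMENTS about `SU(N)` lattice Yang–Mills with the Wilson action and about members of the cell's typed
perturbation balls (track Y2); every window / ball radius / load is where a BOUND is certified to close (a door artefact), not a physical
transition; «hypothesis-free» means «no displayed one-link hypothesis (H1/H2)». WHAT THIS IS NOT: nothing about the crossover, scaling, a continuum
limit, a mass gap at any fixed physical coupling, or the Yang–Mills Millennium problem; `σ`-EXISTENCE for non-Wilson members is never claimed (area-law
BOUNDS and «`σ ≥ c` whenever it exists» only).
* **T42** (seat ds-1 g8; (i)–(iii) = its texts `HOME/ds/ds1g8/lean/V1X-CONJUNCTS-ds1g8.lean` VERBATIM): the strong-coupling DLR state is `C¹` IN THE COUPLING with the fluctuation–response (plaquette-response) series as derivative —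
  `SU(2)` `d = 4` on `0 < β_W < 9/25`, every `SU(N)` hypothesis-free at 't Hooft `< 9/308`; `C¹` only, NOT analyticity.
* **T43** (seat ds-4 g9 text `HOME/ds/ds4/lean/g9/V1XConjunctsDS4g9.lean` VERBATIM): the CENTRE TUBE — ONE `(C, c)` area law for all tori around EVERY centre-blind (twist-blind) action perturbed inside the range-`r`
  tier-1 ball, its `SU(2)` range-1 row, the limit-state string-tension bound, and the explicit-rate rectangle-action row; `K(d,r)` is a counting constant.
* **T44** (seats ds-2 / engine-2 / ds-3): every-`N` rows through the robust star door at 't Hooft `1/64` and `1/36` (`ℤ⁴`, torus `d = 4`, and `d = 3` at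
  `1/24`) + the `SU(3)` rows at the PV modulus (segments up to `β_W = 31/100` on `ℤ⁴` and `12/25` in `d = 3`, one state at `31/100`, string-tension bound at
  `43/100`, the variance-form cell at `1/4`) — ADDITIONAL to T11–T14 / T18 / T24 / T33 / T38, which stay.
* **T47** (seat rb-p2 g5; (i)(iii)(iv) = its texts `HOME/rb/lean-rb-p2/T-texts-rbp2g5.lean` VERBATIM): Wilson's strong-coupling string-tension LAW with explicit O(1) error (`SU(2)`: `|σ − log(4/β_W)| ≤ log 6 + 24β_W` on `0 < β_W ≤ 2/3`;
  every `N`: `|σ − log(N/β)| ≤ log 24 + 24Nβ` on `0 < β ≤ N/24`), its uniform asymptotic form, the two-sided static potential, and the one-state clause on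
  `0 < β_W ≤ 9/25`; leading coefficient exact, constant not sharp.
* **T48** (seat rb-p1 g4; (ii)–(iv) = its text `T_F_LogarithmicRate` of `HOME/pub-ymgap-rb-p1/T-texts-rbp1g4.lean` VERBATIM): the LOGARITHMIC clustering
  rate `log(1/(8β_W))` (constant 16) for every DLR state of `SU(2)` Wilson on `ℤ⁴`, `0 < β_W < 1/8`, its plaquette-decay form, uniformly on the weighted
  loop-action ball of radius `1/10`, and the every-`N` plaquette-decay rate `log(1/(64β))` at 't Hooft `β < 1/64` — coefficient `1` in front of `log(1/β)` vs the
  physical `≈ 4`: a bound, not the sharp rate.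
-/

noncomputable section

namespace Summit.Ventures.YMGap

section T42sec

open MeasureTheory ProbabilityTheory Set
open scoped NNReal
open Literature.MathematicalPhysics.QuantumLattice (LGConfig ZdEdge ZdPlaquette fundamentalRep ymGibbsMeasures)
open Literature.MathematicalPhysics.QuantumFieldTheory hiding ZdEdge

/-- **T42 — strong coupling / track Y2 context: THE DLR STATE IS `C¹` IN THE COUPLING, with the fluctuation–response formula (C-DIFF), KERNEL-CHECKED**
(seat ds-1 g8, namespace `CouplingResponse`; `Thresholds/CouplingDerivative.lean` 355ed9b8b2d0, `Thresholds/CouplingDerivativeSUN.lean` 4dc935f75731;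
conjuncts (i)–(iii) are ds-1's OWN texts `T_SU2CouplingDerivative`, `T_SU2PlaquetteC1`, `T_SUNCouplingDerivative` of
`HOME/ds/ds1g8/lean/V1X-CONJUNCTS-ds1g8.lean` VERBATIM, conjunct (iv) is the type of the tree theorem `hasDerivAt_plaquette_SU_thooft` with its hypotheses as
binders). (i) `SU(2)`, `d = 4`: along ANY selection of DLR states `β_W ↦ μ_{β_W}` on `[0, 9/25]` (one exists, `CouplingResponse.exists_dlrSelection`; the state
is unique there, T9), for every Lipschitz cylinder observable `F` (finite link set `Λ`, constant `K`, links within `D` of a base point `x₀`) and every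
`0 < β_W < 9/25`, `β_W ↦ ⟨F⟩_{β_W}` is differentiable with derivative the response series `Σ_q Cov_{β_W}(F, W_q)`, `W_q = ½ Re tr U_q`
(`CouplingResponse.su2_hasDerivAt_integral_9_25`; the series is absolutely convergent — `CouplingResponse.su2_summable_cov_plaquette_star`, not restated in the
body, which carries the `tsum`); (ii) in particular the mean plaquette `u(β_W) = ⟨W_p⟩_{β_W}` is differentiable on `(0, 9/25)` with derivative the
plaquette susceptibility `Σ_q Cov_{β_W}(W_p, W_q)` (`su2_hasDerivAt_plaquette_9_25`); (iii) every `SU(N)`, `N ≥ 2`, `d = 4`, HYPOTHESIS-FREE (Bakry–Émery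
modulus): along any DLR selection on tree couplings `[0, N·9/308]` ('t Hooft `≤ 9/308`), for every Lipschitz cylinder `F` and every `0 < b < N·9/308`:
`d/db ⟨F⟩_b = N · Σ_q Cov_b(F, W_q)`, `W_q = (1/N) Re tr U_q` (`hasDerivAt_integral_SU_thooft`); (iv) the same for the mean plaquette of every `SU(N)`
(`hasDerivAt_plaquette_SU_thooft`). HONEST LABEL: `C¹` / differentiable in the coupling on cylinder observables — NOT analyticity, no statement about higher
derivatives; lattice strong coupling (class K, one-sided vertex-star window); the windows are where the one-link Dobrushin bound closes, not transitions;
nothing about the continuum or Clay. -/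
def T42_CouplingResponse : Prop :=
  (∀ μ : ℝ → Measure (LGConfig 4 (Matrix.specialUnitaryGroup (Fin 2) ℂ)),
    (∀ βW ∈ Icc (0 : ℝ) (9 / 25), μ βW ∈ ymGibbsMeasures (d := 4) (fundamentalRep (Fin 2)) (2 * (βW / 4))) →
    ∀ (F : LGConfig 4 (Matrix.specialUnitaryGroup (Fin 2) ℂ) → ℝ) (Λ : Finset (ZdEdge 4)) (K : ℝ≥0)
      (x₀ : Literature.Probability.LatticeModels.Site 4) (D : ℕ),
      IsLipschitzCylinder (fundamentalRep (Fin 2)) F Λ K → (∀ e ∈ Λ, ‖e.1 - x₀‖ ≤ D) →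
      ∀ βW ∈ Ioo (0 : ℝ) (9 / 25),
        HasDerivAt (fun t => ∫ U, F U ∂(μ t))
          (∑' q : ZdPlaquette 4, cov[F, zdPlaquetteObs (fundamentalRep (Fin 2)) q.1 q.2.1.1 q.2.1.2; μ βW]) βW) ∧
  (∀ μ : ℝ → Measure (LGConfig 4 (Matrix.specialUnitaryGroup (Fin 2) ℂ)),
    (∀ βW ∈ Icc (0 : ℝ) (9 / 25), μ βW ∈ ymGibbsMeasures (d := 4) (fundamentalRep (Fin 2)) (2 * (βW / 4))) →
    ∀ (p : ZdPlaquette 4), ∀ βW ∈ Ioo (0 : ℝ) (9 / 25),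
      HasDerivAt (fun t => ∫ U, zdPlaquetteObs (fundamentalRep (Fin 2)) p.1 p.2.1.1 p.2.1.2 U ∂(μ t))
        (∑' q : ZdPlaquette 4, cov[zdPlaquetteObs (fundamentalRep (Fin 2)) p.1 p.2.1.1 p.2.1.2,
          zdPlaquetteObs (fundamentalRep (Fin 2)) q.1 q.2.1.1 q.2.1.2; μ βW]) βW) ∧
  (∀ N : ℕ, 2 ≤ N → ∀ μ : ℝ → Measure (LGConfig 4 (Matrix.specialUnitaryGroup (Fin N) ℂ)),
    (∀ b ∈ Icc (0 : ℝ) ((N : ℝ) * (9 / 308)), μ b ∈ ymGibbsMeasures (d := 4) (fundamentalRep (Fin N)) b) →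
    ∀ (F : LGConfig 4 (Matrix.specialUnitaryGroup (Fin N) ℂ) → ℝ) (Λ : Finset (ZdEdge 4)) (K : ℝ≥0)
      (x₀ : Literature.Probability.LatticeModels.Site 4) (D : ℕ),
      IsLipschitzCylinder (fundamentalRep (Fin N)) F Λ K → (∀ e ∈ Λ, ‖e.1 - x₀‖ ≤ D) →
      ∀ b ∈ Ioo (0 : ℝ) ((N : ℝ) * (9 / 308)),
        HasDerivAt (fun t => ∫ U, F U ∂(μ t))
          ((N : ℝ) * ∑' q : ZdPlaquette 4, cov[F, zdPlaquetteObs (fundamentalRep (Fin N)) q.1 q.2.1.1 q.2.1.2; μ b]) b) ∧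
  (∀ N : ℕ, 2 ≤ N → ∀ (μ : ℝ → Measure (LGConfig 4 (Matrix.specialUnitaryGroup (Fin N) ℂ))),
      (∀ b ∈ Icc (0 : ℝ) ((N : ℝ) * (9 / 308)), μ b ∈ ymGibbsMeasures (d := 4) (fundamentalRep (Fin N)) b) →
      ∀ (p : ZdPlaquette 4), ∀ b ∈ Ioo (0 : ℝ) ((N : ℝ) * (9 / 308)),
        HasDerivAt (fun t => ∫ U, zdPlaquetteObs (fundamentalRep (Fin N)) p.1 p.2.1.1 p.2.1.2 U ∂(μ t))
          ((N : ℝ) * ∑' q : ZdPlaquette 4, cov[zdPlaquetteObs (fundamentalRep (Fin N)) p.1 p.2.1.1 p.2.1.2,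
            zdPlaquetteObs (fundamentalRep (Fin N)) q.1 q.2.1.1 q.2.1.2; μ b]) b)

/-- T42 holds (`CouplingResponse.su2_hasDerivAt_integral_9_25`, `su2_hasDerivAt_plaquette_9_25`, `hasDerivAt_integral_SU_thooft`,
`hasDerivAt_plaquette_SU_thooft`; conjuncts (i)–(iii) = seat ds-1 g8's `T_SU2CouplingDerivative` / `T_SU2PlaquetteC1` / `T_SUNCouplingDerivative` texts). -/
theorem T42_CouplingResponse_holds : T42_CouplingResponse :=
  ⟨fun _ hμ _ _ _ _ _ hF hD _ hb => CouplingResponse.su2_hasDerivAt_integral_9_25 hμ hF hD hb,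
    fun _ hμ p _ hb => CouplingResponse.su2_hasDerivAt_plaquette_9_25 hμ p hb,
    fun _ hN _ hμ _ _ _ _ _ hF hD _ hb => CouplingResponse.hasDerivAt_integral_SU_thooft hN hμ hF hD hb,
    fun _ hN _ hμ p _ hb => CouplingResponse.hasDerivAt_plaquette_SU_thooft hN hμ p hb⟩

end T42sec

section T43sec

open MeasureTheory Filter Topology
open Literature.MathematicalPhysics.QuantumLattice
open Literature.MathematicalPhysics.QuantumFieldTheory hiding ZdEdge Site
open Summit.Ventures.YMGap.RobustBall

/-- **T43 — track Y2 (seat ds-4): THE CENTRE TUBE — the tier-1 ball around EVERY centre-blind action keeps the AREA LAW, one `(C, c)`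
for all tori** — (i) CURRENCY THEOREM: for every `N ≥ 2`, every `d`, `r`, `ε₀`, `ε₁` and every `β` with `2(d−1)N|β| + K(d,r) ε₀ < 1`
(`K(d,r) = RobustBall.rowConst d r = ((2r+2)^d − 1)·d·(4r+3)^d`, a COUNTING constant): `AreaLawCentreTubeFR N d β ε₀ ε₁ r`, i.e. there are
`C` and `c > 0` such that for EVERY torus `L`, EVERY twist-blind perturbation `W_b` (any size, any range: adjoint / mixed fundamental–adjoint
actions of any strength, …) and EVERY member `W` of the tier-1 ball `ClusterDomainFR ε₀ ε₁ r` (finite range `r`, oscillation load `≤ ε₀`; the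
Lipschitz radius `ε₁` is idle) the fundamental Wilson loops of `⟨·⟩_{β, W_b + W, L}` obey `|⟨W_{R×T}⟩| ≤ C^{2(R+T)} e^{−c RT}`
(`RobustBall.areaLawCentreTubeFR`; mechanism: centre projection (Fröhlich 1979 / Mack–Petkova 1979) with a flux-local twist defect — every
finite-range gauge-invariant activity has one by the discrete Poincaré lemma — and a windowed Durhuus–Fröhlich `ℤ_N`-layer peeling);
(ii) ROW `SU(2)`, `d = 4`, range `1`: `6 β_W + 2449020 ε₀ < 1 ⇒ AreaLawCentreTubeFR 2 4 β ε₀ ε₁ 1` (`β = β_W/2` the tree coupling;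
`RobustBall.su2_areaLawCentreTubeFR_dim4_range1`); (iii) THE `1×2`-RECTANGLE (Symanzik) MEMBER, explicit constants: `N ≥ 2`, `d ≥ 2`,
`c₀ = 2(d−1)N|β| + 25 d(d−1)|τ| < 1`, `c = −log max(c₀, 1/2)/4`: every infinite-volume limit state of every family whose member at each large
torus is a twist-blind action plus the `1×2`-rectangle action of size `τ` obeys `HasAreaLawWith μ χ_N 2 c` and `σ ≥ c` WHENEVER its string
tension exists (`RobustBall.stringTension_rectangleAction`); (iv) LIMIT STATES OF THE TUBE (`d ≥ 2`): under `AreaLawCentreTubeFR N d β ε₀ ε₁ r`,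
ONE `(C, c)`, `c > 0`, such that every limit state of every eventually-`(W_b + W)` family (`W_b` twist-blind, `W ∈ ClusterDomainFR ε₀ ε₁ r`) obeys
`HasAreaLawWith μ χ_N C c`, `HasAreaLawState`, `σ ≥ c` whenever the string tension exists, and `IsConfining` given existence
(`RobustBall.stringTension_centreTubeFR`).  HONEST LABEL: strong-coupling LATTICE inequality (centre dominance + `ℤ_N`-layer area law);
`K(d,r)` a crude counting constant (qualitative cell); `β`-window smaller than tier 1's; fundamental (nonzero-`N`-ality) loops; `σ`-EXISTENCE for
non-Wilson members is NOT claimed (every string-tension clause is «whenever it exists»); T15's unbounded-range loop terms stay outside;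
nothing continuum / spectral / Clay.  Texts: seat ds-4 (g9), owner countersign of these bytes. -/
def T43_CentreTube : Prop :=
  (∀ (N d : ℕ) [NeZero N], 2 ≤ N → ∀ (β ε₀ ε₁ : ℝ) (r : ℕ),
      2 * ((d - 1 : ℕ) : ℝ) * |β| * N + RobustBall.rowConst d r * ε₀ < 1 → AreaLawCentreTubeFR N d β ε₀ ε₁ r) ∧
  (∀ β ε₀ ε₁ : ℝ, 6 * (2 * |β|) + 2449020 * ε₀ < 1 → AreaLawCentreTubeFR 2 4 β ε₀ ε₁ 1) ∧
  (∀ (N d : ℕ) [NeZero d] [NeZero N], 2 ≤ d → 2 ≤ N → ∀ β τ : ℝ,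
      2 * ((d - 1 : ℕ) : ℝ) * |β| * N + 25 * ((d : ℝ) * ((d : ℝ) - 1)) * |τ| < 1 →
      ∀ 𝓦 : PerturbationFamily d N,
        (∀ᶠ L : ℕ in atTop, ∃ Wb : Perturbation d (L + 1) N,
          IsTwistBlind Wb ∧ 𝓦 L = Wb + termPerturbation (rectFamily d (L + 1) N τ)) →
        ∀ μ ∈ perturbedLimitPoints β 𝓦,
          HasAreaLawWith μ (fun g => normalisedCharacter N (fundamentalRep (Fin N) g)) 2
              (-Real.log (max (2 * ((d - 1 : ℕ) : ℝ) * |β| * N + 25 * ((d : ℝ) * ((d : ℝ) - 1)) * |τ|) (1 / 2)) /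
                ((2 : ℕ) * (2 : ℕ))) ∧
          (∀ σ : ℝ, HasStringTension μ (fun g => normalisedCharacter N (fundamentalRep (Fin N) g)) σ →
              -Real.log (max (2 * ((d - 1 : ℕ) : ℝ) * |β| * N + 25 * ((d : ℝ) * ((d : ℝ) - 1)) * |τ|) (1 / 2)) /
                ((2 : ℕ) * (2 : ℕ)) ≤ σ)) ∧
  (∀ (N d : ℕ) [NeZero d] [NeZero N], 2 ≤ d → ∀ (β ε₀ ε₁ : ℝ) (r : ℕ), AreaLawCentreTubeFR N d β ε₀ ε₁ r →
      ∃ C c : ℝ, 0 < c ∧ ∀ 𝓦 : PerturbationFamily d N,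
        (∀ᶠ L : ℕ in atTop, ∃ Wb W : Perturbation d (L + 1) N,
          IsTwistBlind Wb ∧ W ∈ ClusterDomainFR ε₀ ε₁ r ∧ 𝓦 L = Wb + W) →
          ∀ μ ∈ perturbedLimitPoints β 𝓦,
            HasAreaLawWith μ (fun g => normalisedCharacter N (fundamentalRep (Fin N) g)) C c ∧
            HasAreaLawState μ (fun g => normalisedCharacter N (fundamentalRep (Fin N) g)) ∧
            (∀ σ : ℝ, HasStringTension μ (fun g => normalisedCharacter N (fundamentalRep (Fin N) g)) σ → c ≤ σ) ∧
            ((∃ σ : ℝ, HasStringTension μ (fun g => normalisedCharacter N (fundamentalRep (Fin N) g)) σ) →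
              IsConfining μ (fun g => normalisedCharacter N (fundamentalRep (Fin N) g))))

/-- T43 holds (`RobustBall.areaLawCentreTubeFR`, `RobustBall.su2_areaLawCentreTubeFR_dim4_range1`, `RobustBall.stringTension_rectangleAction`,
`RobustBall.stringTension_centreTubeFR`; seat ds-4 g9 text). -/
theorem T43_CentreTube_holds : T43_CentreTube :=
  ⟨fun _ _ _ hN _ _ ε₁ r hβ => areaLawCentreTubeFR hN ε₁ r hβ,
    fun _ _ ε₁ h => su2_areaLawCentreTubeFR_dim4_range1 ε₁ h,
    fun _ _ _ _ hd hN _ _ hβ => stringTension_rectangleAction hd hN hβ,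
    fun _ _ _ _ hd _ _ _ _ h => stringTension_centreTubeFR hd h⟩

end T43sec

section T44sec

open MeasureTheory Filter Topology
open Literature.Probability.LatticeModels
open Literature.MathematicalPhysics.QuantumLattice hiding torusNorm
open Literature.MathematicalPhysics.QuantumFieldTheory hiding ZdEdge Site
open Literature.Barriers.QuantumFields (IsMassiveState suFundStringTension)
open Summit.Ventures.YMGap.RobustBall

/-- **T44 — track Y2: EVERY-`N` HYPOTHESIS-FREE ROWS THROUGH THE ROBUST STAR DOOR + the `SU(3)` HYPOTHESIS-FREE ROWS AT THE PV MODULUS, KERNEL-CHECKED**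
(seats ds-2 g9 / engine-2 g9 / ds-3 g11; the cell set named by rb-theory 2026-08-23T11:50Z; ADDITIONAL to T11–T14, T18, T24, T33, T38 (v), which stay).
(i)/(ii) `ℤ⁴`, every `N ≥ 2`, every range `R`: `MassGapOnBallZdG 4 N (1/64) (89/250) (89/500) R` and `MassGapOnBallZdG 4 N (1/36) (11/250) (11/500) R` — the
mass gap uniformly on the gauge-invariant tier-1 ball at 't Hooft `1/64` with loads `(.356, .178)` and at 't Hooft `1/36` with loads `(.044, .022)`
(`RobustBall.suN_massGapOnBallZdG_star_64/_36`); (iii) torus form `d = 4` at 't Hooft `1/36`: `∃ A m > 0, TorusClusteringOnBallUpTo N 4 (N/36) (11/250) (11/500) r A m`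
(`suN_torusClusteringOnBallUpTo_star_36`); (iv) `d = 3` at 't Hooft `1/24`: `∃ m > 0`, `YM3IR.ClusterDomainClustering` of the family `ClusterDomainFR (3/50) (3/100) r`
at tree coupling `N/24` in the Frobenius distance, with a torus-clustering witness (`suN_clusterDomainClustering_dim3_star_24`; the Y2 input consumed by the
§Y4 every-`N` ceiling); (v)/(vi) `SU(3)` at p2's PV modulus (no displayed one-link hypothesis): the SEGMENTS `MassGapOnBallZdG 4 3 (β_W/9) (1/100) (1/200) R`
for EVERY `0 ≤ β_W ≤ 31/100` and `MassGapOnBallZdG 3 3 (β_W/9) (3/500) (3/1000) R` for every `0 ≤ β_W ≤ 12/25`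
(`su3_massGapOnBallZdG_pvStar_upTo_thirtyOneHundredths`, `su3_massGapOnBallZdG_dim3_pvStar_upTo_twelveTwentyFifths`); (vii) `SU(3)` at `β_W = 31/100`: ONE
state on `MemBallZdG (1/100) (1/200) R` — unique DLR state = periodised-torus limit, massive, plaquette decay, `HasAreaLawWith μ χ₃ C c`, one `(C, c)` per
`R` (`su3_oneState_pvStar_thirtyOneHundredths`); (viii) `SU(3)` string-tension BOUND on the ball `ClusterDomainFR (9/250) (9/500) r ∩ IsSlabLocal mv` at
`β_W = 43/100`: every limit state has `HasAreaLawWith μ χ₃ C c` and `σ ≥ c` whenever it exists (`RobustBallPV.su3_stringTension_onBall_pv_43_100`); (ix) ds-2's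
variance-form cell `MassGapOnBallZdG 4 3 (1/36) (51/250) (51/500) R` (`SU(3)` at `β_W = 1/4`, loads `(.204, .102)`; `su3_massGapOnBallZdG_starPV_oneQuarter`).
HONEST LABEL: «hypothesis-free» = no displayed one-link hypothesis (H1/H2); radii are door artefacts; strong coupling only; `σ`-existence for non-Wilson
members NOT claimed; nothing continuum. -/
def T44_StarRowsEveryNAndSU3PV : Prop :=
  (∀ N : ℕ, 2 ≤ N → ∀ R : ℕ, MassGapOnBallZdG 4 N (1 / 64) (89 / 250) (89 / 500) R) ∧
  (∀ N : ℕ, 2 ≤ N → ∀ R : ℕ, MassGapOnBallZdG 4 N (1 / 36) (11 / 250) (11 / 500) R) ∧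
  (∀ N : ℕ, 2 ≤ N → ∀ r : ℕ,
      ∃ A m : ℝ, 0 < m ∧ TorusClusteringOnBallUpTo N 4 ((N : ℝ) * (1 / 36)) (11 / 250) (11 / 500) r A m) ∧
  (∀ N : ℕ, 2 ≤ N → ∀ r : ℕ, ∃ m : ℝ, 0 < m ∧
      YM3IR.ClusterDomainClustering (G := SUN N)
        ⟨fundamentalRep (Fin N), (N : ℝ) * (1 / 24), fun _ _ W => W ∈ ClusterDomainFR (3 / 50) (3 / 100) r⟩ suFrobDist m ∧
      ∃ A : ℝ, TorusClusteringOnBallUpTo N 3 ((N : ℝ) * (1 / 24)) (3 / 50) (3 / 100) r A m) ∧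
  (∀ βW : ℝ, 0 ≤ βW → βW ≤ 31 / 100 → ∀ R : ℕ, MassGapOnBallZdG 4 3 (βW / 9) (1 / 100) (1 / 200) R) ∧
  (∀ βW : ℝ, 0 ≤ βW → βW ≤ 12 / 25 → ∀ R : ℕ, MassGapOnBallZdG 3 3 (βW / 9) (3 / 500) (3 / 1000) R) ∧
  (∀ R : ℕ, ∃ C c : ℝ, 0 < c ∧ ∀ (W : Potential (ZdEdge 4) (SUN 3)) (supp : Finset (ZdEdge 4) → Finset (Finset (ZdEdge 4)))
      (hmem : MemBallZdG (1 / 100) (1 / 200) R W supp) (hdep : ∀ X, DependsOn (W X) (↑X : Set (ZdEdge 4)))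
      (hg : ∀ X, IsZdGaugeInvariant (W X)) (hm : ∀ X, Measurable (W X)) (hb : ∀ X, ∃ C, ∀ U, |W X U| ≤ C),
      ∃ μ : Measure (LGConfig 4 (SUN 3)),
        perturbedGibbsMeasures (d := 4) (fundamentalRep (Fin 3)) (((3 : ℕ) : ℝ) * ((31 / 100 : ℝ) / 9)) W supp = {μ} ∧
        perturbedLimitPoints (((3 : ℕ) : ℝ) * ((31 / 100 : ℝ) / 9)) (periodisedFamily W supp hdep hg hm hb) = {μ} ∧
        IsMassiveState μ ∧ HasExponentialDecay (plaquetteCorrFn (fundamentalRep (Fin 3)) μ) ∧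
        HasAreaLawWith μ (fun g => normalisedCharacter 3 (fundamentalRep (Fin 3) g)) C c) ∧
  (∀ (r mv : ℕ), 1 ≤ mv → ∃ C c : ℝ, 0 < c ∧ ∀ 𝓦 : PerturbationFamily 4 3,
      (∀ᶠ L : ℕ in atTop, 𝓦 L ∈ ClusterDomainFR (2 * (9 / 500)) (9 / 500) r ∧ IsSlabLocal mv (𝓦 L)) →
        ∀ μ ∈ perturbedLimitPoints ((43 / 100 : ℝ) / 3) 𝓦,
          HasAreaLawWith μ (fun g => normalisedCharacter 3 (fundamentalRep (Fin 3) g)) C c ∧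
          ((∃ σ : ℝ, HasStringTension μ (fun g => normalisedCharacter 3 (fundamentalRep (Fin 3) g)) σ) →
            c ≤ suFundStringTension 3 μ)) ∧
  (∀ Rr : ℕ, MassGapOnBallZdG 4 3 (1 / 36) (51 / 250) (51 / 500) Rr)

/-- T44 holds (`suN_massGapOnBallZdG_star_64`, `suN_massGapOnBallZdG_star_36`, `suN_torusClusteringOnBallUpTo_star_36`,
`suN_clusterDomainClustering_dim3_star_24`, `su3_massGapOnBallZdG_pvStar_upTo_thirtyOneHundredths`, `su3_massGapOnBallZdG_dim3_pvStar_upTo_twelveTwentyFifths`,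
`su3_oneState_pvStar_thirtyOneHundredths`, `RobustBallPV.su3_stringTension_onBall_pv_43_100`, `su3_massGapOnBallZdG_starPV_oneQuarter`). -/
theorem T44_StarRowsEveryNAndSU3PV_holds : T44_StarRowsEveryNAndSU3PV :=
  ⟨fun _ hN R => suN_massGapOnBallZdG_star_64 hN R, fun _ hN R => suN_massGapOnBallZdG_star_36 hN R,
    fun _ hN r => suN_torusClusteringOnBallUpTo_star_36 hN r, fun _ hN r => suN_clusterDomainClustering_dim3_star_24 hN r,
    fun _ h0 h R => su3_massGapOnBallZdG_pvStar_upTo_thirtyOneHundredths h0 h R,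
    fun _ h0 h R => su3_massGapOnBallZdG_dim3_pvStar_upTo_twelveTwentyFifths h0 h R,
    fun R => su3_oneState_pvStar_thirtyOneHundredths R,
    fun r _ hmv => RobustBallPV.su3_stringTension_onBall_pv_43_100 r hmv,
    fun Rr => su3_massGapOnBallZdG_starPV_oneQuarter Rr⟩

end T44sec

section T47sec

open MeasureTheory Filter Topology
open Literature.Probability.LatticeModels
open Literature.MathematicalPhysics.QuantumLattice
open Literature.MathematicalPhysics.QuantumFieldTheory hiding ZdEdge Site
open Summit.Ventures.YMGap.RobustBall Summit.Ventures.YMGap.RobustBall.StringTensionExplicit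

/-- **T47 — WILSON ACTION, STRONG COUPLING: WILSON'S STRING-TENSION LAW `σ = log(4/β_W) + O(1)` / `σ = log(N/β) + O(1)` with explicit constants, its
asymptotic form, the two-sided static potential, and the ONE-STATE clause, KERNEL-CHECKED** (seat rb-p2 g5; `RobustBall/StringTensionSharp.lean` 7b090831863c,
`StringTensionLawAsymptotic.lean` 85b31c319a73, `StaticPotentialEveryN.lean` 840feeed49aa; conjuncts (i), (iii), (iv) are rb-p2's OWN texts
`T_SU2StringTensionStrongCouplingLawDim4Sharp`, `T_SUNStringTensionStrongCouplingLawDim4`, `T_SUNStaticPotentialLinearDim4` of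
`HOME/rb/lean-rb-p2/T-texts-rbp2g5.lean` VERBATIM; (ii) and (v) are the types of the hypothesis-free tree theorems named; statements about the unperturbed
Wilson action and the infinite-volume limit points of ITS torus states). (i) `SU(2)`, `d = 4`, every `0 < β_W ≤ 2/3`, every limit point `μ` at tree coupling
`β_W/2`: `|σ(μ) − log(4/β_W)| ≤ log 6 + 24 β_W` (`≤ 1.80 + 24β_W`; `log(4/β_W)` = the leading term of the strong-coupling series;
`su2_stringTension_sub_log4_abs_le_dim4`; floor = Dobrushin door, ceiling = one-link plaquette floor with the EXACT `V₀(SU(2)) = 1`); (ii) hence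
`σ(μ)/log(4/β_W) → 1` uniformly over the limit points as `β_W → 0⁺`: `∀ ε > 0 ∃ β₀ > 0 ∀ 0 < β_W ≤ β₀ ∀ μ, |σ(μ)/log(4/β_W) − 1| ≤ ε`
(`su2_stringTension_law_uniform_limit_dim4`); (iii) every `N ≥ 2`, `d = 4`, tree coupling `0 < β ≤ N/24`, every limit point: `|σ(μ) − log(N/β)| ≤ log 24 + 24Nβ`
(`suN_stringTension_sub_log_abs_le_dim4`); (iv) the static quark potential is LINEAR up to certified constants there:
`(log(N/β) − log 24)·R − 2 log(8N⁴/(3β)) ≤ V_μ(R) ≤ (log(N/β) + log 12 + 24Nβ)·R` for every `R ≥ 1` (`suN_staticPotential_two_sided_dim4`); (v) `SU(2)`,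
`d = 4`, every `0 < β_W ≤ 9/25`: there is ONE state — the only torus limit point and the only DLR state — with `MassGapAt 4 2 (β_W/4)`, whose string
tension EXISTS (Wilson's formula) and obeys (i) (`su2_oneState_law_dim4`). Here `σ(μ) = stringTension μ χ_N` (the tree's string-tension functional of the
fundamental Wilson loops) and `V_μ = staticPotential μ χ_N`. HONEST LABEL: Wilson's strong-coupling law on the LATTICE with O(1) error — leading coefficient
exact, the constants door / one-link artefacts (not sharp); nothing about the crossover, scaling, the continuum, spectra or Clay. -/
def T47_WilsonStrongCouplingLaw : Prop :=
  (∀ βW : ℝ, 0 < βW → βW ≤ 2 / 3 →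
    ∀ μ ∈ infiniteVolumeLimitPoints (d := 4) (fundamentalRep (Fin 2)) (βW / 2),
      |stringTension μ (fun g => normalisedCharacter 2 (fundamentalRep (Fin 2) g)) - Real.log (4 / βW)| ≤
        Real.log 6 + 24 * βW) ∧
  (∀ ε : ℝ, 0 < ε → ∃ β₀ : ℝ, 0 < β₀ ∧ ∀ βW : ℝ, 0 < βW → βW ≤ β₀ →
      ∀ μ ∈ infiniteVolumeLimitPoints (d := 4) (fundamentalRep (Fin 2)) (βW / 2),
        |stringTension μ (fun g => normalisedCharacter 2 (fundamentalRep (Fin 2) g)) / Real.log (4 / βW) - 1| ≤ ε) ∧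
  (∀ N : ℕ, 2 ≤ N → ∀ β : ℝ, 0 < β → β ≤ N / 24 →
    ∀ μ ∈ infiniteVolumeLimitPoints (d := 4) (fundamentalRep (Fin N)) β,
      |stringTension μ (fun g => normalisedCharacter N (fundamentalRep (Fin N) g)) - Real.log (N / β)| ≤
        Real.log 24 + 24 * N * β) ∧
  (∀ N : ℕ, 2 ≤ N → ∀ β : ℝ, 0 < β → β ≤ N / 24 →
    ∀ μ ∈ infiniteVolumeLimitPoints (d := 4) (fundamentalRep (Fin N)) β, ∀ R : ℕ, 1 ≤ R →
      (Real.log (N / β) - Real.log 24) * R - 2 * Real.log (8 * (N : ℝ) ^ 4 / (3 * β)) ≤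
          staticPotential μ (fun g => normalisedCharacter N (fundamentalRep (Fin N) g)) R ∧
        staticPotential μ (fun g => normalisedCharacter N (fundamentalRep (Fin N) g)) R ≤
          (Real.log (N / β) + Real.log 12 + 24 * N * β) * R) ∧
  (∀ βW : ℝ, 0 < βW → βW ≤ 9 / 25 →
      ∃ μ : Measure (LGConfig 4 (SUN 2)),
        infiniteVolumeLimitPoints (d := 4) (fundamentalRep (Fin 2)) (βW / 2) = {μ} ∧
        ymGibbsMeasures (d := 4) (fundamentalRep (Fin 2)) (βW / 2) = {μ} ∧
        MassGapAt 4 2 (βW / 4) ∧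
        HasStringTension μ (fun g => normalisedCharacter 2 (fundamentalRep (Fin 2) g))
          (stringTension μ (fun g => normalisedCharacter 2 (fundamentalRep (Fin 2) g))) ∧
        |stringTension μ (fun g => normalisedCharacter 2 (fundamentalRep (Fin 2) g)) - Real.log (4 / βW)| ≤ Real.log 6 + 24 * βW)

/-- T47 holds (`StringTensionExplicit.su2_stringTension_sub_log4_abs_le_dim4`, `su2_stringTension_law_uniform_limit_dim4`,
`suN_stringTension_sub_log_abs_le_dim4`, `suN_staticPotential_two_sided_dim4`, `su2_oneState_law_dim4`; (i)/(iii)/(iv) = seat rb-p2 g5's texts). -/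
theorem T47_WilsonStrongCouplingLaw_holds : T47_WilsonStrongCouplingLaw :=
  ⟨fun _ hβ hβ1 _ hμ => su2_stringTension_sub_log4_abs_le_dim4 hβ hβ1 hμ, su2_stringTension_law_uniform_limit_dim4,
    fun _ hN _ hβ hβ1 _ hμ => suN_stringTension_sub_log_abs_le_dim4 hN hβ hβ1 hμ,
    fun _ hN _ hβ hβ1 _ hμ R hR => suN_staticPotential_two_sided_dim4 hN hβ hβ1 hμ R hR,
    fun _ hβ hle => su2_oneState_law_dim4 hβ hle⟩

end T47sec

section T48sec

open MeasureTheory Filter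
open Literature.Probability.LatticeModels
open Literature.MathematicalPhysics.QuantumLattice
open Literature.MathematicalPhysics.QuantumFieldTheory hiding ZdEdge Site plaquetteObs
open Summit.Ventures.YMGap.RobustBall

/-- **T48 — WILSON ACTION + THE LOOP-ACTION BALL, `d = 4`: THE CERTIFIED RATE GROWS LOGARITHMICALLY AT STRONG COUPLING, `log(1/(8β_W))` for `SU(2)` /
`log(1/(64β))` for every `SU(N)`, HYPOTHESIS-FREE, KERNEL-CHECKED** (seat rb-p1 g4; `RobustBall/UniformRateStrongCoupling.lean` 840feeed49aa; conjunct (i) is the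
type of the booked tree theorem `su2_wilson_clustering_rate`, conjuncts (ii)–(iv) are rb-p1's OWN text `T_F_LogarithmicRate` of
`HOME/pub-ymgap-rb-p1/T-texts-rbp1g4.lean` VERBATIM). (i) For every `0 < β_W < 1/8`, EVERY DLR state of the `SU(2)` Wilson action on `ℤ⁴` (tree coupling
`β_W/2`, 't Hooft slot `β_W/4`) clusters exponentially at RATE `m = log(1/(8β_W))` per lattice unit with constant `16`: for Lipschitz cylinder observables
`F₁, F₂` on disjoint link sets of size `≤ n`, `|Cov(F₁, F₂)| ≤ 16 n² e^{−m·dist} (K₁K₂ + ‖F₁‖₂‖F₂‖₂)` (`RobustBall.su2_wilson_clustering_rate`, the body of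
`PerturbedClustering 4 2 (β_W/4) 0 ∅ m 16`); (ii) in particular every such DLR state has `HasExponentialDecayRate (plaquetteCorrFn … μ) (log(1/(8β_W)))`
(`su2_wilson_hasExponentialDecayRate_plaquetteCorrFn_rate`); (iii) the same rate UNIFORMLY on the ball of generic Wilson-type LOOP actions
`S_W + Σ_i c_i Re tr(U_{γ_i})/2` with `LoopNormLE m γ c (1/10)` — the weighted `sup_e Σ_{i ∋ e} |c_i| Σ_{y ∈ γ_i} e^{m‖e − y‖_∞}` norm of radius `1/10` at
weight rate `w = m`: one DLR state and `PerturbedClusteringS` with `(m, 16)` for every member (`su2_uniformLoopBall_rate`, the body of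
`UniformMassGapOnLoopBall 4 2 (β_W/4) m (1/10) m 16`); (iv) every `N ≥ 2`, 't Hooft `0 < β < 1/64`: every DLR state of the `SU(N)` Wilson action at tree coupling
`Nβ` has plaquette–plaquette decay at rate `log(1/(64β))` (`suN_wilson_hasExponentialDecayRate_plaquetteCorrFn_rate`). HONEST LABEL: the certified rate grows
like `1·log(1/β)` (Dobrushin lower bound) — the physical strong-coupling mass gap is `≈ 4 log(1/β_W)`, so this is a BOUND, not the sharp rate; strong coupling
only; nothing continuum. -/
def T48_LogarithmicRate : Prop :=
  (∀ βW : ℝ, 0 < βW → βW < 1 / 8 →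
      PerturbedClustering 4 2 (βW / 4) 0 (fun _ => (∅ : Finset (Finset (ZdEdge 4)))) (Real.log (1 / (8 * βW))) 16) ∧
  (∀ βW : ℝ, 0 < βW → βW < 1 / 8 →
      ∀ μ ∈ Literature.MathematicalPhysics.QuantumLattice.ymGibbsMeasures (d := 4) (fundamentalRep (Fin 2)) (βW / 2),
        Literature.Probability.LatticeModels.HasExponentialDecayRate
          (Literature.MathematicalPhysics.QuantumLattice.plaquetteCorrFn (fundamentalRep (Fin 2)) μ) (Real.log (1 / (8 * βW)))) ∧
    (∀ βW : ℝ, 0 < βW → βW < 1 / 8 →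
      UniformMassGapOnLoopBall 4 2 (βW / 4) (Real.log (1 / (8 * βW))) (1 / 10) (Real.log (1 / (8 * βW))) 16) ∧
    (∀ N : ℕ, 2 ≤ N → ∀ β : ℝ, 0 < β → β < 1 / 64 →
      ∀ μ ∈ Literature.MathematicalPhysics.QuantumLattice.ymGibbsMeasures (d := 4) (fundamentalRep (Fin N)) (N * β),
        Literature.Probability.LatticeModels.HasExponentialDecayRate
          (Literature.MathematicalPhysics.QuantumLattice.plaquetteCorrFn (fundamentalRep (Fin N)) μ) (Real.log (1 / (64 * β))))

/-- T48 holds (`RobustBall.su2_wilson_clustering_rate`; rb-p1's `T_F_LogarithmicRate` proof terms: `su2_wilson_hasExponentialDecayRate_plaquetteCorrFn_rate`,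
`su2_uniformLoopBall_rate`, `suN_wilson_hasExponentialDecayRate_plaquetteCorrFn_rate`). -/
theorem T48_LogarithmicRate_holds : T48_LogarithmicRate :=
  ⟨fun _ h0 h => su2_wilson_clustering_rate h0 h,
    fun _ h0 h _ hμ => su2_wilson_hasExponentialDecayRate_plaquetteCorrFn_rate h0 h hμ, fun _ h0 h => su2_uniformLoopBall_rate h0 h,
    fun _ hN _ h0 h _ hμ => suN_wilson_hasExponentialDecayRate_plaquetteCorrFn_rate hN h0 h hμ⟩

end T48sec

end Summit.Ventures.YMGap

end
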